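import Summits.ResolutionOfSingularities.ResolutionOfSingularities.Theorems.PurelyInseparableDim4ResConeCInfPinning
import HarnessLib
import HarnessLib.Audit.Tags

/-!
# Purely inseparable four-folds — C∞ PINNING OF THE CONTACT LETTER FOR EVERY PRIME `p` ((VT-f) ∀ p): in a straight
# light-pair power-cone state of order `d + 2`, `d + 1 = p`, a slot step that keeps the order does not translate the
# contact letter (cell `res-dim4-pi`, K2(p) lane, rung-1 POWER-CONE LINE «light pair of TAIL(p, p−1, 3) ∀ p», window
# half W2; the `p = 5` instance is res-dim4-typ-1 g2's `…ResConeCInfPinning` p690352)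

[OURS · counted 0 · cell `res-dim4-pi` · K2(p) lane (holder res-dim4-p-12 g5, rulings g5-2 (6) / g5-6) · seat res-dim4-typ-1 g5.]
Nothing here proves K2(p) for any `p`, any TAIL(p, p−1, 3), any TAIL(7, d, e), `NoIsolatedTrap p p` or resolution of
singularities in dimension ≥ 4 / characteristic `p` — NOT proved.  AI kernel work, weaker than expert review.  A state-level
reading lemma for OUR frame; kills nothing by itself.

Setting (fixed coordinates): ledger `r = x_λ x_μ`, order `d + 2` with `d + 1 = p`, and the STRAIGHT contact presentation
`in F = a · x^r · x_f^d` (`a ≠ 0`).  A `Step p` in the slot chart `λ` with translation vector `b` (`b_λ = 0` chart letter,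
`b_μ = 0` kept weight) reads, at the degree-`2` exponent `x_λ x_μ` of the child, the single number `a · b_f^d`
(§1 `coeff_pair_step_eq_prime`: chart law at `x_λ^p x_μ`, Hauser's shear of the initial form, and
`(x_f + b_f x_λ)^d ≡ b_f^d x_λ^d (mod x_f)`); so if the child has order `> 2` (in the window: order `d + 2` again) then
`b_f = 0` (§2 **`cInf_translation_contact_eq_zero_prime`**, **`…_of_le_prime`**).  DICTIONARY against `5`: `x_f⁴ ↦ x_f^d`,
`ordZero 6 ↦ d + 2`, `x_λ⁵ x_μ ↦ x_λ^p x_μ`.  The VIRTUAL window uses this at every virtual state (the real chain has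
res-dim4-p-2 g4's chain-level `translation_contact_eq_zero_of_straight` instead).
[cite: Hauser2010, §§F, I] [cite: CossartJannsenSaito2020, Thm. 3.14]
bears_on: LADDER-RESOLUTION:D157-DOOR2 (res-dim4-pi · K2(p) · power cones · (VT-f) ∀ p).  Supports
stmt-ResolutionOfSingularities-16155 (helper).
-/

set_option linter.dupNamespace false -- mandated namespace of this single-conjunct summit

namespace Summit.ResolutionOfSingularities.ResolutionOfSingularities.Theorems.PIDim4

namespace ResCone

open MvPolynomial Finset
open Literature.AlgebraicGeometry.Resolution
open Literature.AlgebraicGeometry.Resolution.CentreBlowup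
open Literature.AlgebraicGeometry.Resolution.Hauser2010
open Literature.AlgebraicGeometry.Resolution.HauserPerlega2019

variable {K : Type} [Field K] [DecidableEq K]

/-! ## 1. The reading at `x_λ x_μ` after a `λ`-step with translation `b`, every degree -/

omit [DecidableEq K] in
/-- Hauser's shear of the straight initial monomial, every degree: `shear_λ^b (a·x_λ x_μ x_f^d) = a·x_λ·x_μ·(x_f + b_f x_λ)^d`
when `b_μ = 0`. [cite: Hauser2010, §I (definition of P⁺)] -/
theorem shear_monomial_pair_contact_pow {lam mu f : Fin 4} (hml : mu ≠ lam) (hfl : f ≠ lam) {b : Fin 4 → K}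
    (hbm : b mu = 0) (a : K) (d : ℕ) :
    shear lam b (monomial (Finsupp.single lam 1 + Finsupp.single mu 1 + Finsupp.single f d) a) =
      C a * X lam * X mu * (X f + C (b f) * X lam) ^ d := by
  have hmon : (monomial (Finsupp.single lam 1 + Finsupp.single mu 1 + Finsupp.single f d) a :
      MvPolynomial (Fin 4) K) = C a * X lam * X mu * X f ^ d := by
    rw [X_pow_eq_monomial, X, X, C_mul_monomial, monomial_mul, monomial_mul, mul_one, mul_one, mul_one]
  rw [hmon]
  unfold shear
  rw [map_mul, map_mul, map_mul, map_pow, aeval_C, aeval_X, aeval_X, aeval_X, if_pos rfl, if_neg hml,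
    if_neg hfl, hbm, C_0, zero_mul, add_zero, algebraMap_eq]

omit [DecidableEq K] in
/-- The `x_λ^{d+1} x_μ`-coefficient of `a·x_λ·x_μ·(x_f + γ x_λ)^d` is `a γ^d` (`(x_f + γx_λ)^d ≡ γ^d x_λ^d (mod x_f)`), every
degree. [folklore] -/
theorem coeff_pair_contact_shear_pow {lam mu f : Fin 4} (hfl : f ≠ lam) (hfm : f ≠ mu) (a γ : K) (d : ℕ) :
    coeff (Finsupp.single lam (d + 1) + Finsupp.single mu 1)
        (C a * X lam * X mu * (X f + C γ * X lam) ^ d : MvPolynomial (Fin 4) K) = a * γ ^ d := by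
  obtain ⟨R, hR⟩ := sub_dvd_pow_sub_pow (X f + C γ * X lam : MvPolynomial (Fin 4) K) (C γ * X lam) d
  rw [add_sub_cancel_right] at hR
  have hsplit : (C a * X lam * X mu * (X f + C γ * X lam) ^ d : MvPolynomial (Fin 4) K) =
      monomial (Finsupp.single lam (d + 1) + Finsupp.single mu 1) (a * γ ^ d) + X f * (C a * X lam * X mu * R) := by
    have h4 : ((X f + C γ * X lam) ^ d : MvPolynomial (Fin 4) K) = (C γ * X lam) ^ d + X f * R := by
      rw [← hR]; ring
    have hm : (monomial (Finsupp.single lam (d + 1) + Finsupp.single mu 1) (a * γ ^ d) : MvPolynomial (Fin 4) K) =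
        C (a * γ ^ d) * (X lam ^ (d + 1) * X mu) := by
      rw [X_pow_eq_monomial, X, monomial_mul, C_mul_monomial, mul_one, mul_one]
    rw [h4, hm, map_mul, map_pow, mul_pow, ← C_pow, pow_succ]; ring
  rw [hsplit, coeff_add, coeff_monomial, if_pos rfl, coeff_X_mul', if_neg, add_zero]
  rw [Finsupp.mem_support_iff, not_not, Finsupp.add_apply, Finsupp.single_apply, Finsupp.single_apply,
    if_neg hfl.symm, if_neg hfm.symm, zero_add]

/-- **The reading at `x_λ x_μ` of the child, every prime.**  For a state of order `d + 2` (`d + 1 = p`) with straight contact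
initial form `in F = a·x^r x_f^d`, `r = x_λ x_μ`, the `Step p` in chart `λ` with translations `b` (`b_λ = b_μ = 0`) has
`coeff_{x_λ x_μ} F′ = a · b_f^d`. [OURS] [cite: Hauser2010, §§F, I] -/
theorem coeff_pair_step_eq_prime (p : ℕ) [hp : Fact p.Prime] {d : ℕ} (hdp : d + 1 = p) {lam mu f : Fin 4}
    (hml : mu ≠ lam) (hfl : f ≠ lam) (hfm : f ≠ mu) {s : State K} (ho : ordZero s.F = ((d + 2 : ℕ) : ℕ∞)) {a : K}
    (hin : initialForm s.F = monomial (Finsupp.single lam 1 + Finsupp.single mu 1 + Finsupp.single f d) a)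
    {b : Fin 4 → K} (hbl : b lam = 0) (hbm : b mu = 0) :
    coeff (Finsupp.single lam 1 + Finsupp.single mu 1) (CentreBlowup.step p Finset.univ lam b s).F =
      a * b f ^ d := by
  have hq : ((p : ℕ) : ℕ∞) ≤ ordAlong Finset.univ s.F := by
    rw [ordAlong_univ, ho]; exact_mod_cast (by omega : p ≤ d + 2)
  -- the chart preimage of `x_λ x_μ` is `x_λ^p x_μ = x_λ^{d+1} x_μ`
  have hdeg : (Finsupp.single lam (d + 1) + Finsupp.single mu 1 : Fin 4 →₀ ℕ).degree = d + 2 := by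
    simp only [map_add, Finsupp.degree_single]
  have hmu1 : (Finsupp.single lam (d + 1) + Finsupp.single mu 1 : Fin 4 →₀ ℕ) mu = 1 := by
    rw [Finsupp.add_apply, Finsupp.single_eq_of_ne hml, Finsupp.single_eq_same, zero_add]
  have hce : chartExponent p Finset.univ lam (Finsupp.single lam (d + 1) + Finsupp.single mu 1) =
      Finsupp.single lam 1 + Finsupp.single mu 1 := by
    apply Finsupp.ext
    intro i
    by_cases hi : i = lam
    · subst hi
      rw [chartExponent, degIn_univ, hdeg, Finsupp.coe_update, Function.update_self, Finsupp.add_apply,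
        Finsupp.single_eq_same, Finsupp.single_eq_of_ne hml.symm, add_zero]
      omega
    · rw [chartExponent_apply_of_ne p Finset.univ hi, Finsupp.add_apply, Finsupp.add_apply, Finsupp.single_eq_of_ne hi,
        Finsupp.single_eq_of_ne hi]
  have hnp : ¬ IsPthPowerExponent p (chartExponent p Finset.univ lam
      (Finsupp.single lam (d + 1) + Finsupp.single mu 1)) := by
    rw [hce]
    refine not_isPthPowerExponent_of_not_dvd (i := mu) ?_
    rw [Finsupp.add_apply, Finsupp.single_eq_of_ne hml, Finsupp.single_eq_same, zero_add, Nat.dvd_one]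
    exact hp.out.ne_one
  have h := coeff_step_F_chartExponent p lam hbl s hq (e := Finsupp.single lam (d + 1) + Finsupp.single mu 1)
    (by rw [hdeg]; omega)
  rw [if_neg hnp, hce, coeff_shear_eq_coeff_shear_initialForm_of_degree_eq lam b ho hdeg, hin,
    shear_monomial_pair_contact_pow hml hfl hbm, coeff_pair_contact_shear_pow hfl hfm] at h
  exact h

/-! ## 2. Pinning of the contact letter, every prime -/

/-- **C∞ PINNING, contact half, every prime** ((VT-f) ∀ p): in the setting of `coeff_pair_step_eq_prime` with `a ≠ 0`, if the
child has order `> 2` — stated as «at least `3`», all that is used — then the contact letter was NOT translated: `b_f = 0`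
(otherwise the child contains `a b_f^d · x_λ x_μ`, of degree `2`). [OURS] [cite: CossartJannsenSaito2020, Thm. 9.3 (setting)] -/
theorem cInf_translation_contact_eq_zero_of_le_prime (p : ℕ) [hp : Fact p.Prime] {d : ℕ} (hdp : d + 1 = p)
    {lam mu f : Fin 4} (hml : mu ≠ lam) (hfl : f ≠ lam) (hfm : f ≠ mu) {s : State K}
    (ho : ordZero s.F = ((d + 2 : ℕ) : ℕ∞)) {a : K} (ha : a ≠ 0)
    (hin : initialForm s.F = monomial (Finsupp.single lam 1 + Finsupp.single mu 1 + Finsupp.single f d) a)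
    {b : Fin 4 → K} (hbl : b lam = 0) (hbm : b mu = 0)
    (ho' : ((3 : ℕ) : ℕ∞) ≤ ordZero (CentreBlowup.step p Finset.univ lam b s).F) : b f = 0 := by
  have h := coeff_pair_step_eq_prime p hdp hml hfl hfm ho hin hbl hbm
  have h0 : coeff (Finsupp.single lam 1 + Finsupp.single mu 1) (CentreBlowup.step p Finset.univ lam b s).F = 0 := by
    apply coeff_eq_zero_of_degree_lt_ordZero
    refine lt_of_lt_of_le ?_ ho'
    simp only [map_add, Finsupp.degree_single]
    exact_mod_cast (by norm_num : (1 + 1 : ℕ) < 3)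
  rw [h0] at h
  have hd0 : d ≠ 0 := by
    rintro rfl
    exact hp.out.ne_one (by omega)
  have h4 : b f ^ d = 0 := by
    rcases mul_eq_zero.mp h.symm with h1 | h1
    · exact absurd h1 ha
    · exact h1
  exact pow_eq_zero_iff hd0 |>.mp h4

/-- **C∞ PINNING, contact half, every prime** — the window form: the child again has order `d + 2`. [OURS]
[cite: CossartJannsenSaito2020, Thm. 9.3 (setting)] -/
theorem cInf_translation_contact_eq_zero_prime (p : ℕ) [hp : Fact p.Prime] {d : ℕ} (hdp : d + 1 = p)
    {lam mu f : Fin 4} (hml : mu ≠ lam) (hfl : f ≠ lam) (hfm : f ≠ mu) {s : State K}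
    (ho : ordZero s.F = ((d + 2 : ℕ) : ℕ∞)) {a : K} (ha : a ≠ 0)
    (hin : initialForm s.F = monomial (Finsupp.single lam 1 + Finsupp.single mu 1 + Finsupp.single f d) a)
    {b : Fin 4 → K} (hbl : b lam = 0) (hbm : b mu = 0)
    (ho' : ordZero (CentreBlowup.step p Finset.univ lam b s).F = ((d + 2 : ℕ) : ℕ∞)) : b f = 0 := by
  have hd1 : 1 ≤ d := by
    rcases Nat.eq_zero_or_pos d with rfl | hd
    · exact absurd (by omega : p = 1) hp.out.ne_one
    · exact hd
  refine cInf_translation_contact_eq_zero_of_le_prime p hdp hml hfl hfm ho ha hin hbl hbm ?_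
  rw [ho']
  exact_mod_cast (by omega : 3 ≤ d + 2)

end ResCone

end Summit.ResolutionOfSingularities.ResolutionOfSingularities.Theorems.PIDim4
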